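import Summits.Ventures.Crystal3D.Theorems.StickyWulffConstantNoReconstructionGainGrainCount
import Literature.MathematicalPhysics.StatisticalMechanics.BarlowCoordination
import HarnessLib

/-!
# Transport families of a Barlow stacking and the segment formula for the deficiency

HONEST FRAMING. Part of the venture `Summits/Ventures/Crystal3D` (cell `crystal3d-full`), helper
`--supports` the crux `NoReconstructionGain` (stmt-Ventures-19144, route
`route-Ventures-StickyWulffConstant`), line `adhesion`, GRAIN RUNG.  Pure lattice combinatorics on
the site set `ℤ × ℤ × ℤ` of a Barlow stacking `barlowStacking 1 √(2/3) σ` (site `(k, i, j)` ↦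
`barlowPos 1 √(2/3) σ k i j`; `σ` a Hägg sequence).

The twelve neighbours of a site (`dist_barlowPos_eq_iff`, `…BarlowCoordination`) are organised
into SIX TRANSPORT FAMILIES, each an injective self-map `T` of the site set together with its
inverse: the three in-layer translations by `(1,0)`, `(0,1)`, `(1,−1)`, and three interlayer
"chain" maps `(k,i,j) ↦ (k+1, (i,j) − off_m k)` where, for every layer `k`, `off_0 k, off_1 k,
off_2 k` enumerate the three adjacent-layer offsets `threeOffsets (−σ k) = {(0,0), (σ k, 0),
(0, σ k)}` (ANY layer-dependent enumeration — a "schedule").  For a finite set of sites `Q` the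
degree sum splits accordingly (`sum_card_adj_eq`):
`Σ_{x∈Q} #{y ∈ Q : dist = 1} + 2·(Σ_families #{x ∈ Q : T x ∉ Q}) = 12·#Q`,
i.e. the contact deficiency `6#Q − ½Σ deg` equals the total number of maximal `T`-segments of
`Q` over the six families.  This is the bookkeeping behind the grain rung: a family whose steps
all rise (or all fall) by more than the toucher band pays one unit of deficiency per ball touching
the substrate (`…GrainCount`).

WHAT THIS IS NOT: any geometry of the substrate; rung F-C1 not moved.
-/

noncomputable section

namespace Summit.Ventures.Crystal3D.Theorems

open Finset Real
open Literature.MathematicalPhysics.StatisticalMechanics (barlowPos barlowStacking IsHaggSeq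
  sixOffsets threeOffsets dist_barlowPos_eq_iff barlowPos_apply_two)

/-! ## The offsets -/

/-- The adjacent-layer offsets for letter shift `−s` are `(0,0), (s,0), (0,s)` (`s = ±1`). -/
theorem mem_threeOffsets_neg_iff {s : ℤ} (hs : s = 1 ∨ s = -1) (PQ : ℤ × ℤ) :
    PQ ∈ threeOffsets (-s) ↔ PQ = (0, 0) ∨ PQ = (s, 0) ∨ PQ = (0, s) := by
  obtain ⟨P, Q⟩ := PQ
  rcases hs with rfl | rfl
  · simp [threeOffsets]
  · simp [threeOffsets]

/-- The adjacent-layer offsets for letter shift `s` are `(0,0), (−s,0), (0,−s)` (`s = ±1`). -/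
theorem mem_threeOffsets_iff_neg {s : ℤ} (hs : s = 1 ∨ s = -1) (PQ : ℤ × ℤ) :
    PQ ∈ threeOffsets s ↔ PQ = (0, 0) ∨ PQ = (-s, 0) ∨ PQ = (0, -s) := by
  obtain ⟨P, Q⟩ := PQ
  rcases hs with rfl | rfl
  · simp [threeOffsets]
  · simp [threeOffsets]

/-- The six in-layer offsets, explicitly. -/
theorem mem_sixOffsets_iff' (PQ : ℤ × ℤ) :
    PQ ∈ sixOffsets ↔ PQ = (1, 0) ∨ PQ = (-1, 0) ∨ PQ = (0, 1) ∨ PQ = (0, -1) ∨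
      PQ = (1, -1) ∨ PQ = (-1, 1) := by
  obtain ⟨P, Q⟩ := PQ
  simp [sixOffsets]

/-! ## Counting lemmas for one family -/

section OneFamily

variable {ι : Type*} [DecidableEq ι]

/-- `#{x ∈ Q : T x ∈ Q} + #{x ∈ Q : T x ∉ Q} = #Q`. -/
theorem card_filter_succ_mem_add (Q : Finset ι) (T : ι → ι) :
    (Q.filter fun x => T x ∈ Q).card + (Q.filter fun x => T x ∉ Q).card = Q.card :=
  card_filter_add_card_filter_not _

/-- `#{x ∈ Q : x ∈ T(Q)} + #{x ∈ Q : T x ∉ Q} = #Q` for injective `T` (bottoms = tops). -/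
theorem card_filter_mem_image_add (Q : Finset ι) (T : ι → ι) (hT : Function.Injective T) :
    (Q.filter fun x => x ∈ Q.image T).card + (Q.filter fun x => T x ∉ Q).card = Q.card := by
  rw [card_filter_succ_not_mem_eq Q T hT]
  exact card_filter_add_card_filter_not _

end OneFamily

/-! ## Sites, positions, adjacency -/

/-- Adjacency of sites of the ideal stacking in coordinates: two sites are at distance `1` iff
they are in-layer neighbours (six offsets) or adjacent-layer neighbours (three offsets each way). -/
theorem site_adj_iff {σ : ℤ → ℤ} (hσ : IsHaggSeq σ) (x y : ℤ × ℤ × ℤ) :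
    dist (barlowPos 1 (Real.sqrt (2 / 3)) σ x.1 x.2.1 x.2.2)
        (barlowPos 1 (Real.sqrt (2 / 3)) σ y.1 y.2.1 y.2.2) = 1 ↔
      (y.1 = x.1 ∧ (x.2.1 - y.2.1, x.2.2 - y.2.2) ∈ sixOffsets) ∨
      (y.1 = x.1 + 1 ∧ (x.2.1 - y.2.1, x.2.2 - y.2.2) ∈ threeOffsets (-σ x.1)) ∨
      (y.1 = x.1 - 1 ∧ (x.2.1 - y.2.1, x.2.2 - y.2.2) ∈ threeOffsets (σ (x.1 - 1))) := by
  have hh : Real.sqrt (2 / 3) ^ 2 = 2 / 3 * (1 : ℝ) ^ 2 := by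
    rw [Real.sq_sqrt (by norm_num)]; ring
  exact dist_barlowPos_eq_iff hσ one_pos hh x.1 x.2.1 x.2.2 y.1 y.2.1 y.2.2

/-- A filter whose predicate says "belongs to an explicit finite set `Z`" is counted by summing
the indicator of `Q` over `Z`. -/
theorem card_filter_mem_eq_sum {ι : Type*} [DecidableEq ι] (Q Z : Finset ι) :
    (Q.filter fun y => y ∈ Z).card = ∑ z ∈ Z, if z ∈ Q then 1 else 0 := by
  rw [Finset.sum_boole]
  congr 1
  ext y
  simp only [mem_filter, and_comm]

/-! ## The degree of a site splits over the six families -/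

/-- **In-layer degree.**  For a site `x` and a finite set of sites `Q`, the number of in-layer
neighbours of `x` in `Q` is the sum over the six in-layer offsets `d` of `[x + d ∈ Q]` (written as
three translations and their inverses). -/
theorem card_inLayer_adj (Q : Finset (ℤ × ℤ × ℤ)) (x : ℤ × ℤ × ℤ) :
    (Q.filter fun y => y.1 = x.1 ∧ (x.2.1 - y.2.1, x.2.2 - y.2.2) ∈ sixOffsets).card =
      (if (x.1, x.2.1 + 1, x.2.2) ∈ Q then 1 else 0) + (if (x.1, x.2.1 - 1, x.2.2) ∈ Q then 1 else 0) +
      (if (x.1, x.2.1, x.2.2 + 1) ∈ Q then 1 else 0) + (if (x.1, x.2.1, x.2.2 - 1) ∈ Q then 1 else 0) +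
      (if (x.1, x.2.1 + 1, x.2.2 - 1) ∈ Q then 1 else 0) +
        (if (x.1, x.2.1 - 1, x.2.2 + 1) ∈ Q then 1 else 0) := by
  obtain ⟨k, i, j⟩ := x
  set Z : Finset (ℤ × ℤ × ℤ) := {(k, i + 1, j), (k, i - 1, j), (k, i, j + 1), (k, i, j - 1),
    (k, i + 1, j - 1), (k, i - 1, j + 1)} with hZ
  have hfilt : (Q.filter fun y => y.1 = k ∧ (i - y.2.1, j - y.2.2) ∈ sixOffsets) =
      Q.filter fun y => y ∈ Z := by
    refine filter_congr fun y _ => ?_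
    obtain ⟨k', i', j'⟩ := y
    rw [mem_sixOffsets_iff', hZ]
    simp only [Prod.mk.injEq, mem_insert, mem_singleton]
    omega
  simp only
  rw [hfilt, card_filter_mem_eq_sum, hZ]
  rw [sum_insert (by simp only [mem_insert, mem_singleton, Prod.mk.injEq]; omega),
    sum_insert (by simp only [mem_insert, mem_singleton, Prod.mk.injEq]; omega),
    sum_insert (by simp only [mem_insert, mem_singleton, Prod.mk.injEq]; omega),
    sum_insert (by simp only [mem_insert, mem_singleton, Prod.mk.injEq]; omega),
    sum_insert (by simp only [mem_singleton, Prod.mk.injEq]; omega), sum_singleton]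
  ring

/-- **Upward degree.**  With `off m k` (`m : Fin 3`) a layer-dependent enumeration of the three
adjacent-layer offsets `threeOffsets (−σ k)`, the number of neighbours of `x` in the next layer
lying in `Q` is `Σ_m [(x.1 + 1, x.2 − off m x.1) ∈ Q]`. -/
theorem card_up_adj {σ : ℤ → ℤ} (off : Fin 3 → ℤ → ℤ × ℤ)
    (hmem : ∀ m k, off m k ∈ threeOffsets (-σ k))
    (hinj : ∀ k, Function.Injective fun m => off m k)
    (Q : Finset (ℤ × ℤ × ℤ)) (x : ℤ × ℤ × ℤ) :
    (Q.filter fun y => y.1 = x.1 + 1 ∧ (x.2.1 - y.2.1, x.2.2 - y.2.2) ∈ threeOffsets (-σ x.1)).card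
      = ∑ m : Fin 3, if (x.1 + 1, x.2.1 - (off m x.1).1, x.2.2 - (off m x.1).2) ∈ Q then 1 else 0 := by
  obtain ⟨k, i, j⟩ := x
  simp only
  set F : Fin 3 → ℤ × ℤ × ℤ := fun m => (k + 1, i - (off m k).1, j - (off m k).2) with hF
  have hFinj : Function.Injective F := by
    intro m m' h
    simp only [hF, Prod.mk.injEq] at h
    have h2 : off m k = off m' k := Prod.ext (by omega) (by omega)
    exact hinj k h2
  -- the three offsets are all of `threeOffsets (-σ k)`
  have hsurj : ∀ PQ ∈ threeOffsets (-σ k), ∃ m, off m k = PQ := by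
    intro PQ hPQ
    have hcard : (univ.image fun m : Fin 3 => off m k).card = 3 := by
      rw [card_image_of_injective _ (hinj k)]; simp
    have hsub : (univ.image fun m : Fin 3 => off m k) ⊆ threeOffsets (-σ k) := by
      intro PQ hPQ'
      obtain ⟨m, -, rfl⟩ := mem_image.1 hPQ'
      exact hmem m k
    have hc3 : (threeOffsets (-σ k)).card = 3 :=
      Literature.MathematicalPhysics.StatisticalMechanics.card_threeOffsets _
    have heq := eq_of_subset_of_card_le hsub (by rw [hcard, hc3])
    rw [← heq] at hPQ
    obtain ⟨m, -, hm⟩ := mem_image.1 hPQ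
    exact ⟨m, hm⟩
  have hfilt : (Q.filter fun y => y.1 = k + 1 ∧ (i - y.2.1, j - y.2.2) ∈ threeOffsets (-σ k)) =
      Q.filter fun y => y ∈ univ.image F := by
    refine filter_congr fun y _ => ?_
    obtain ⟨k', i', j'⟩ := y
    simp only [mem_image, mem_univ, true_and, hF, Prod.mk.injEq]
    constructor
    · rintro ⟨rfl, hm⟩
      obtain ⟨m, hm'⟩ := hsurj _ hm
      refine ⟨m, rfl, ?_, ?_⟩ <;> rw [hm'] <;> simp
    · rintro ⟨m, hk, hi, hj⟩
      refine ⟨hk.symm, ?_⟩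
      have e : (i - i', j - j') = off m k := by
        refine Prod.ext ?_ ?_ <;> simp <;> omega
      rw [e]; exact hmem m k
  rw [hfilt, card_filter_mem_eq_sum, sum_image fun m _ m' _ h => hFinj h]

/-- **Downward degree.**  With the same enumeration, the number of neighbours of `x` in the
previous layer lying in `Q` is `Σ_m [(x.1 − 1, x.2 + off m (x.1 − 1)) ∈ Q]` — the predecessors of
`x` along the three chain maps. -/
theorem card_down_adj {σ : ℤ → ℤ} (hσ : IsHaggSeq σ) (off : Fin 3 → ℤ → ℤ × ℤ)
    (hmem : ∀ m k, off m k ∈ threeOffsets (-σ k))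
    (hinj : ∀ k, Function.Injective fun m => off m k)
    (Q : Finset (ℤ × ℤ × ℤ)) (x : ℤ × ℤ × ℤ) :
    (Q.filter fun y => y.1 = x.1 - 1 ∧
        (x.2.1 - y.2.1, x.2.2 - y.2.2) ∈ threeOffsets (σ (x.1 - 1))).card
      = ∑ m : Fin 3, if (x.1 - 1, x.2.1 + (off m (x.1 - 1)).1, x.2.2 + (off m (x.1 - 1)).2) ∈ Q
          then 1 else 0 := by
  obtain ⟨k, i, j⟩ := x
  simp only
  set F : Fin 3 → ℤ × ℤ × ℤ := fun m => (k - 1, i + (off m (k - 1)).1, j + (off m (k - 1)).2)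
    with hF
  have hFinj : Function.Injective F := by
    intro m m' h
    simp only [hF, Prod.mk.injEq] at h
    have h2 : off m (k - 1) = off m' (k - 1) := Prod.ext (by omega) (by omega)
    exact hinj (k - 1) h2
  have hs : σ (k - 1) = 1 ∨ σ (k - 1) = -1 := hσ (k - 1)
  -- membership in `threeOffsets (σ (k-1))` means the negative is one of the `off m (k-1)`
  have hsurj : ∀ PQ ∈ threeOffsets (-σ (k - 1)), ∃ m, off m (k - 1) = PQ := by
    intro PQ hPQ
    have hcard : (univ.image fun m : Fin 3 => off m (k - 1)).card = 3 := by
      rw [card_image_of_injective _ (hinj (k - 1))]; simp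
    have hsub : (univ.image fun m : Fin 3 => off m (k - 1)) ⊆ threeOffsets (-σ (k - 1)) := by
      intro PQ hPQ'
      obtain ⟨m, -, rfl⟩ := mem_image.1 hPQ'
      exact hmem m (k - 1)
    have hc3 : (threeOffsets (-σ (k - 1))).card = 3 :=
      Literature.MathematicalPhysics.StatisticalMechanics.card_threeOffsets _
    have heq := eq_of_subset_of_card_le hsub (by rw [hcard, hc3])
    rw [← heq] at hPQ
    obtain ⟨m, -, hm⟩ := mem_image.1 hPQ
    exact ⟨m, hm⟩
  have hneg : ∀ PQ : ℤ × ℤ, PQ ∈ threeOffsets (σ (k - 1)) ↔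
      (-PQ.1, -PQ.2) ∈ threeOffsets (-σ (k - 1)) := by
    intro PQ
    rw [mem_threeOffsets_iff_neg hs, mem_threeOffsets_neg_iff hs]
    obtain ⟨P, Q'⟩ := PQ
    simp only [Prod.mk.injEq]
    omega
  have hfilt : (Q.filter fun y => y.1 = k - 1 ∧
      (i - y.2.1, j - y.2.2) ∈ threeOffsets (σ (k - 1))) = Q.filter fun y => y ∈ univ.image F := by
    refine filter_congr fun y _ => ?_
    obtain ⟨k', i', j'⟩ := y
    simp only [mem_image, mem_univ, true_and, hF, Prod.mk.injEq]
    rw [hneg]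
    constructor
    · rintro ⟨rfl, hm⟩
      obtain ⟨m, hm'⟩ := hsurj _ hm
      refine ⟨m, rfl, ?_, ?_⟩
      · have := congrArg Prod.fst hm'; simp at this; omega
      · have := congrArg Prod.snd hm'; simp at this; omega
    · rintro ⟨m, hk, hi, hj⟩
      refine ⟨hk.symm, ?_⟩
      have e : (-(i - i'), -(j - j')) = off m (k - 1) := by
        refine Prod.ext ?_ ?_ <;> simp <;> omega
      simp only
      rw [e]; exact hmem m (k - 1)
  rw [hfilt, card_filter_mem_eq_sum, sum_image fun m _ m' _ h => hFinj h]

/-! ## Summing over the set: each family contributes `#Q − #segments` twice -/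

section Sums

variable {ι : Type*} [DecidableEq ι]

/-- `Σ_{x ∈ Q} [T x ∈ Q] = #Q − #{x ∈ Q : T x ∉ Q}` (as an additive identity). -/
theorem sum_ite_succ_mem_add (Q : Finset ι) (T : ι → ι) :
    (∑ x ∈ Q, if T x ∈ Q then 1 else 0) + (Q.filter fun x => T x ∉ Q).card = Q.card := by
  rw [Finset.sum_boole]
  exact_mod_cast card_filter_add_card_filter_not (s := Q) (fun x => T x ∈ Q)

/-- `Σ_{x ∈ Q} [S x ∈ Q] = #Q − #{x ∈ Q : T x ∉ Q}` when `S` is a two-sided inverse of the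
injective map `T` (predecessors: bottoms = tops). -/
theorem sum_ite_pred_mem_add (Q : Finset ι) (T S : ι → ι) (hTS : ∀ x, T (S x) = x)
    (hST : ∀ x, S (T x) = x) :
    (∑ x ∈ Q, if S x ∈ Q then 1 else 0) + (Q.filter fun x => T x ∉ Q).card = Q.card := by
  have hT : Function.Injective T := fun a b h => by rw [← hST a, ← hST b, h]
  have hiff : ∀ x, S x ∈ Q ↔ x ∈ Q.image T := by
    intro x
    rw [mem_image]
    constructor
    · intro h; exact ⟨S x, h, hTS x⟩
    · rintro ⟨z, hz, rfl⟩; rw [hST]; exact hz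
  have : (∑ x ∈ Q, if S x ∈ Q then 1 else 0) = (Q.filter fun x => x ∈ Q.image T).card := by
    rw [Finset.sum_boole]
    push_cast
    congr 1
    exact filter_congr fun x _ => hiff x
  rw [this]
  exact card_filter_mem_image_add Q T hT

end Sums

/-- **The segment formula for the degree sum.**  For a Hägg sequence `σ`, a schedule `off`
(layer-wise enumeration of the adjacent-layer offsets) and a finite set of sites `Q`:
`Σ_{x ∈ Q} #{y ∈ Q : dist = 1} + 2·(#segments of the three in-layer translations and of the
three chain maps) = 12 · #Q`.  Equivalently the contact deficiency `6#Q − ½ Σ deg` of the sites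
`Q` equals the total number of maximal segments of `Q` over the six transport families. -/
theorem sum_card_adj_add {σ : ℤ → ℤ} (hσ : IsHaggSeq σ) (off : Fin 3 → ℤ → ℤ × ℤ)
    (hmem : ∀ m k, off m k ∈ threeOffsets (-σ k))
    (hinj : ∀ k, Function.Injective fun m => off m k) (Q : Finset (ℤ × ℤ × ℤ)) :
    (∑ x ∈ Q, (Q.filter fun y => dist (barlowPos 1 (Real.sqrt (2 / 3)) σ x.1 x.2.1 x.2.2)
        (barlowPos 1 (Real.sqrt (2 / 3)) σ y.1 y.2.1 y.2.2) = 1).card) +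
      2 * ((Q.filter fun x => (x.1, x.2.1 + 1, x.2.2) ∉ Q).card +
           (Q.filter fun x => (x.1, x.2.1, x.2.2 + 1) ∉ Q).card +
           (Q.filter fun x => (x.1, x.2.1 + 1, x.2.2 - 1) ∉ Q).card +
           ∑ m : Fin 3, (Q.filter fun x =>
             (x.1 + 1, x.2.1 - (off m x.1).1, x.2.2 - (off m x.1).2) ∉ Q).card) =
      12 * Q.card := by
  -- split the degree of each site over the three layer relations
  have hdeg : ∀ x ∈ Q, (Q.filter fun y => dist (barlowPos 1 (Real.sqrt (2 / 3)) σ x.1 x.2.1 x.2.2)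
        (barlowPos 1 (Real.sqrt (2 / 3)) σ y.1 y.2.1 y.2.2) = 1).card =
      ((if (x.1, x.2.1 + 1, x.2.2) ∈ Q then 1 else 0) + (if (x.1, x.2.1 - 1, x.2.2) ∈ Q then 1 else 0) +
      (if (x.1, x.2.1, x.2.2 + 1) ∈ Q then 1 else 0) + (if (x.1, x.2.1, x.2.2 - 1) ∈ Q then 1 else 0) +
      (if (x.1, x.2.1 + 1, x.2.2 - 1) ∈ Q then 1 else 0) +
        (if (x.1, x.2.1 - 1, x.2.2 + 1) ∈ Q then 1 else 0)) +
      (∑ m : Fin 3, if (x.1 + 1, x.2.1 - (off m x.1).1, x.2.2 - (off m x.1).2) ∈ Q then 1 else 0) +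
      (∑ m : Fin 3, if (x.1 - 1, x.2.1 + (off m (x.1 - 1)).1, x.2.2 + (off m (x.1 - 1)).2) ∈ Q
          then 1 else 0) := by
    intro x _
    rw [← card_inLayer_adj Q x, ← card_up_adj off hmem hinj Q x,
      ← card_down_adj hσ off hmem hinj Q x]
    rw [← card_union_of_disjoint, ← card_union_of_disjoint]
    · congr 1
      ext y
      simp only [mem_union, mem_filter]
      rw [site_adj_iff hσ x y]
      tauto
    · rw [disjoint_left]
      intro y hy hy'
      rcases mem_union.1 hy with h | h
      · have h1 := (mem_filter.1 h).2.1
        have h2 := (mem_filter.1 hy').2.1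
        omega
      · have h1 := (mem_filter.1 h).2.1
        have h2 := (mem_filter.1 hy').2.1
        omega
    · rw [disjoint_left]
      intro y hy hy'
      have h1 := (mem_filter.1 hy).2.1
      have h2 := (mem_filter.1 hy').2.1
      omega
  rw [sum_congr rfl hdeg]
  simp only [sum_add_distrib]
  -- the six in-layer indicator sums
  have e1 := sum_ite_succ_mem_add Q (fun x : ℤ × ℤ × ℤ => (x.1, x.2.1 + 1, x.2.2))
  have e1' := sum_ite_pred_mem_add Q (fun x : ℤ × ℤ × ℤ => (x.1, x.2.1 + 1, x.2.2))
    (fun x => (x.1, x.2.1 - 1, x.2.2)) (fun x => by simp) (fun x => by simp)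
  have e2 := sum_ite_succ_mem_add Q (fun x : ℤ × ℤ × ℤ => (x.1, x.2.1, x.2.2 + 1))
  have e2' := sum_ite_pred_mem_add Q (fun x : ℤ × ℤ × ℤ => (x.1, x.2.1, x.2.2 + 1))
    (fun x => (x.1, x.2.1, x.2.2 - 1)) (fun x => by simp) (fun x => by simp)
  have e3 := sum_ite_succ_mem_add Q (fun x : ℤ × ℤ × ℤ => (x.1, x.2.1 + 1, x.2.2 - 1))
  have e3' := sum_ite_pred_mem_add Q (fun x : ℤ × ℤ × ℤ => (x.1, x.2.1 + 1, x.2.2 - 1))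
    (fun x => (x.1, x.2.1 - 1, x.2.2 + 1)) (fun x => by simp) (fun x => by simp)
  -- the chain sums
  have e4 : ∀ m : Fin 3, (∑ x ∈ Q, if (x.1 + 1, x.2.1 - (off m x.1).1, x.2.2 - (off m x.1).2) ∈ Q
      then 1 else 0) + (Q.filter fun x =>
        (x.1 + 1, x.2.1 - (off m x.1).1, x.2.2 - (off m x.1).2) ∉ Q).card = Q.card :=
    fun m => sum_ite_succ_mem_add Q _
  have e5 : ∀ m : Fin 3, (∑ x ∈ Q, if (x.1 - 1, x.2.1 + (off m (x.1 - 1)).1,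
      x.2.2 + (off m (x.1 - 1)).2) ∈ Q then 1 else 0) + (Q.filter fun x =>
        (x.1 + 1, x.2.1 - (off m x.1).1, x.2.2 - (off m x.1).2) ∉ Q).card = Q.card := by
    intro m
    refine sum_ite_pred_mem_add Q (fun x : ℤ × ℤ × ℤ =>
      (x.1 + 1, x.2.1 - (off m x.1).1, x.2.2 - (off m x.1).2))
      (fun x => (x.1 - 1, x.2.1 + (off m (x.1 - 1)).1, x.2.2 + (off m (x.1 - 1)).2)) ?_ ?_
    · intro x
      obtain ⟨k, i, j⟩ := x
      simp only [sub_add_cancel, Prod.mk.injEq]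
      exact ⟨trivial, by ring, by ring⟩
    · intro x
      obtain ⟨k, i, j⟩ := x
      simp only [add_sub_cancel_right, Prod.mk.injEq]
      exact ⟨trivial, by ring, by ring⟩
  have e45 : (∑ x ∈ Q, ∑ m : Fin 3, if (x.1 + 1, x.2.1 - (off m x.1).1, x.2.2 - (off m x.1).2) ∈ Q
      then 1 else 0) + (∑ x ∈ Q, ∑ m : Fin 3, if (x.1 - 1, x.2.1 + (off m (x.1 - 1)).1,
        x.2.2 + (off m (x.1 - 1)).2) ∈ Q then 1 else 0) +
      2 * ∑ m : Fin 3, (Q.filter fun x =>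
        (x.1 + 1, x.2.1 - (off m x.1).1, x.2.2 - (off m x.1).2) ∉ Q).card = 6 * Q.card := by
    rw [sum_comm (s := Q), sum_comm (s := Q), two_mul, Fin.sum_univ_three, Fin.sum_univ_three,
      Fin.sum_univ_three]
    linarith [e4 0, e4 1, e4 2, e5 0, e5 1, e5 2]
  linarith [e1, e1', e2, e2', e3, e3']

end Summit.Ventures.Crystal3D.Theorems

end
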